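import Mathlib
import HarnessLib
import HarnessLib.Audit
import Summits.AtomisticToContinuum.Statement
import Literature.MathematicalPhysics.QuantumManyBody.PeriodicBoseGas
import Literature.MathematicalPhysics.QuantumLattice.QuantumRotorGroundState
import HarnessLib.Audit.Status.Attr

/-!
Route: BECSyncSkeleton

DORMANT since 2026-08-29T19:26:34Z (census g0: costume|duplicate of —; reader census-reader-33-g0) — unstaffed, not closed; items shared with open routes are served there. `ledger route dormant <id> --off` reactivates.

# Route BECSyncSkeleton — block phases synchronise by ferromagnetic domination — integer-filled
block–pocket rotor skeleton, Ginibre monotonicity down to the rotor anchor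

It suffices to show X = X_eng ∧ X_dom ∧ X_bc (card sync-instead-of-rp; sibling of
integer-block-rotor-rp, whose block/rotor reduction it shares and
whose reflection-positivity engine it replaces by CORRELATION-INEQUALITY DOMINATION).
X_eng (decl InhomogeneousRotorLRO, rank 2, Literature-grade): ground-state long-range order of
ferromagnetic quantum rotor arrays that CONTAIN the
3-torus (ℤ/K)³ inside an arbitrary finite decoration (extra "pocket" sites, extra ferromagnetic
bonds of any range), with ONE-SIDED hypotheses only
(inertia = h₀ on the torus sites, coupling ≥ J₀ on the torus nearest-neighbour bonds, J₀/h₀ large):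
Σ_{x,y∈(ℤ/K)³}⟨cos(φ_x − φ_y)⟩ ≥ c₀K⁶ for all
near-minimisers, uniformly in K and in the decoration — what Ginibre's inequality (PROVED in tree)
plus the homogeneous rotor anchor
(QuantumRotor.KleinPerez1992_rotorGroundStateLRO, in print) give, and what reflection positivity
alone cannot (no translation invariance).
X_dom (decl SkeletonDomination, rank 3, THE BET): at ONE fixed healing-window block scale L/K ∈
[A,2A]ρ^(-1/2), near-minimisers Ψ of the periodic
N-body energy have block coherences dominating (1−η)·n̄ × the phase coherences of SOME skeleton in
X_eng's class (K³ integer-filled blocks + integer-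
filled corner pockets absorbing N mod K³): K³·⟨φ₀,γ_Ψφ₀⟩ + ηNK³ ≥ (1−η)(N/K³)·Σ_{x,y}⟨cos(φ_ex −
φ_ey)⟩_Φ for a near-minimiser Φ of the skeleton.
X_bc (decl BoundaryTransferWeak, rank 4, shared stmt-AtomisticToContinuum-0827): periodic
constant-mode BEC ⇒ Dirichlet HasGroundStateBEC.
Target (rank 0) PeriodicCondensation = the PeriodicBEC body of stmt-0826, reached from X_eng ∧ X_dom
by the support item SkeletonCounting.
Lean: `InhomogeneousRotorLRO ∧ SkeletonDomination ∧ BoundaryTransferWeak`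

## Assembly
Pure logic (glue.lean, rc 0 inside Sketch.lean): for admissible v, `SkeletonCounting
InhomogeneousRotorLRO SkeletonDomination v hv` is the
PeriodicBEC hypothesis of `BoundaryTransferWeak v hv`, whose conclusion ∃ρ₀>0 ∀ρ∈(0,ρ₀)
HasGroundStateBEC v ρ is the body of the sub-problem
Statement decl `BoseEinsteinCondensation` (root abbrev of the Literature constant; `closes`
concludes the Statement decl BY NAME, checked by `rfl`
against `_root_.BoseEinsteinCondensation` in Sketch.lean — the defect that retired BECBlockRotorRP /
BECVortexSheetDuality is not repeated).
DECIDING THEOREM `closes (h₂ : InhomogeneousRotorLRO) (h₃ : SkeletonDomination) (h₉ :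
SkeletonCounting) (h₄ : BoundaryTransferWeak) :
BoseEinsteinCondensation := fun v hv => h₄ v hv (h₉ h₂ h₃ v hv)`; PeriodicCondensation (target) is
derived, not assumed.

Rationale: WHY THIS LINE. The card's engine (GarbanSpencer2022: Nishimori gauge + AbbeEtAl2018 synchronization
+ MessagerMiraclesolePfister1978/Ginibre1970 domination) is RP-free and
tolerant of inhomogeneity; this planning pass found that its correlation-inequality half is the
load-bearing part and is PROVED in the tree
(`Literature.Probability.LatticeModels.ginibreExpect_reChar_mono`): inside Ginibre's
generalised-ferromagnetic cone every lower bound is monotone in the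
couplings, so an inhomogeneous, longer-range, pocket-decorated rotor skeleton is at least as ordered
as its homogeneous nearest-neighbour minorant — the
rotor anchor (WojtkiewiczPuszStachura2016 Thm 3.3, Wojtkiewicz2012, KleinPerez1992; vocabulary
`QuantumRotor.*` in tree AND, since 2026-08-15 18:35Z,
its proof `QuantumRotor.KleinPerez1992_rotorGroundStateLRO_holds` (α_c = 16; Galerkin truncation +
RP + KLS infrared bound + sum rule,
Literature/MathematicalPhysics/QuantumLattice/QuantumRotorGroundStateLROProofs.lean) — the anchor is
a THEOREM, not a hypothesis) — while the synchronization
and Wells engines (GarbanSpencer2022, DarioGarban2025 = arXiv:2311.16546) stay in reserve for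
degenerate skeletons. What inhomogeneity-tolerance buys the
Bose gas is concrete: integer block filling is forced by positivity of the phase representation
(flux (n−α)² is complex unless α ∈ ℤ, even at T = 0), and
with K³ equal blocks that means K³ | N — route BECBlockRotorRP's crux FillingRemainder ("possibly as
hard as BEC"); here r = (N − K³m)/m_p integer-filled
POCKETS absorb every N exactly, the array loses all reflection symmetry, and Ginibre simply drops
the pockets. Imported areas: correlation inequalities
of classical lattice spin systems run in the Feynman–Kac/Trotter path space of rotors (statistical
mechanics), Kron reduction of Laplacians
(DorflerBullo2013: Schur complements of ferromagnetic quadratic forms stay ferromagnetic — why the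
delivered class is Ginibre's at harmonic level),
Anderson–Leggett block number–phase variables (FisherEtAl1989, Leggett2001), and the in-tree
dilute-gas cell theorems (LSSY2005, Fournais2020, Junge2026)
inside blocks. No prior route states a correlation-INEQUALITY engine; negatives index (6 entries)
contains nothing on block phases.

RANKED CRUXES. #0 PeriodicCondensation (target) — periodic constant-mode condensation (verbatim the
body of BECPeriodicReduction.PeriodicBEC, stmt-AtomisticToContinuum-0826): for every repulsive
finite-range v there is ρ₀ > 0 such that for 0 < ρ < ρ₀ some c > 0 bounds, for all large N and some
δ > 0, the constant-mode occupation of every periodic δ-near-minimiser on the torus of side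
(N/ρ)^(1/3) from below by cN. Reached from ranks 2–3 by SkeletonCounting; not a hypothesis of
`closes`. (why it might fail: It is thermodynamic-limit BEC in the periodic setting (open since
1947): every printed bound on n+ pays the inverse kinetic gap L^2 (Fournais2020 Thm 1.2, Junge2026
Cor 6), and c must be uniform in N and cover hard cores.) [LSSY2005, Fournais2020, Junge2026]
#2 InhomogeneousRotorLRO (crux) — ENGINE (card item S1 / the anchor; d = 3, T = 0). Cone status
(route-repair 2026-08-15): the homogeneous anchor QuantumRotor.KleinPerez1992_rotorGroundStateLRO is
PROVED in tree (`KleinPerez1992_rotorGroundStateLRO_holds`, α_c = 16, landed 18:35Z, 19 min before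
this route opened), the gate's cone of this route has 0 unproved constants out of 38, and no item
takes a named fact as hypothesis; what remains of rank 2 is (i) T = 0 Ginibre/Griffiths-II
monotonicity in the couplings for DECORATED arrays and (ii) the transfer from the anchor's
liminf-over-even-tori, inf-sup rendering (`torusCorrelation`, `HasLongRangeOrder`) to a
near-minimiser bound Σ cosCorrelation ≥ c₀K⁶ at each fixed large even K, uniformly in the
decoration. There is α_c > 0 and, for every g > α_c, constants c₀ > 0 and K₀ such that for every
even K ≥ K₀, every n and injective e : (ℤ/K)³ → Fin n, every inertia field h > 0 with h(e x) = h₀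
and every symmetric coupling J ≥ 0 with J(e x, e(x+e_i)) ≥ J₀, J₀/h₀ ≥ g (pockets and extra bonds
arbitrary), the rotor array H = Σ_a (h_a/2)(−∂²_φa) − Σ_(a<b) J_ab cos(φ_a − φ_b) on Fin n
satisfies: for some δ > 0 every δ-near-minimiser Ψ of its quadratic form (the in-tree
QuantumRotor.TrialState / angleCell vocabulary, energy written inline with site- and bond-dependent
couplings) has Σ_(x,y∈(ℤ/K)³) cosCorrelation Ψ (e x) (e y) ≥ c₀K⁶. Intended proof: Ginibre II in the
Trotterised path-space representation (theta-function time kernels and e^(εJ cos) are in Ginibre's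
cone; monotone in every J_ab — in tree as ginibreExpect_reChar_mono for exp-linear weights) removes
pockets and extra bonds and lowers torus bonds to J₀; the homogeneous even torus is the named fact,
now the in-tree theorem KleinPerez1992_rotorGroundStateLRO_holds (WojtkiewiczPuszStachura2016 Thm
3.3 by RP + KLS; RP-free alternatives: GarbanSpencer2022 / DarioGarban2025 after Trotter);
uniqueness + gap at fixed K turn the sup-rendering into the near-minimiser form. NOT claimed:
monotonicity in h (1/ϑ₃ has alternating Fourier signs), hence h = h₀ exactly on torus sites.
[difficulty: L] (why it might fail: T=0 Ginibre monotonicity for rotor arrays is folklore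
(KleinPerez1992 p.243, no printed proof); the in-tree anchor (alpha_c = 16) is a liminf over even
tori of an inf-sup rendering, not a near-minimiser bound at fixed K; Trotter and beta->infinity
limits must commute with the inequality.) [Ginibre1970, KleinPerez1992, WojtkiewiczPuszStachura2016,
Wojtkiewicz2012, GarbanSpencer2022, DarioGarban2025, KLS1988PRL, DriesslerLandauPerez1979]
#3 SkeletonDomination (crux) — THE BET (card item S2, typed as a domination INEQUALITY with constant
1 − η rather than as a bare implication). For every repulsive finite-range v, every g > 0 and η > 0
there are A > 0 and ρ₀ > 0 such that for 0 < ρ < ρ₀, every K₀ and all large N: there are an even K ≥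
K₀ with A ρ^(-1/2) ≤ L/K ≤ 2A ρ^(-1/2) (L = (N/ρ)^(1/3); ONE fixed healing-window scale) and a
skeleton in the engine's class — n, injective e : (ℤ/K)³ → Fin n, h > 0 with h = h₀ on blocks,
symmetric J ≥ 0 with J ≥ J₀ on block nearest-neighbour bonds, J₀/h₀ ≥ g (intended: K³ blocks of
integer filling m, r = (N − K³m)/m_p corner pockets of integer filling m_p ≫ 1 with gcd(K³, m_p) =
1, Josephson couplings E_J ≍ ρ(L/K), charging h₀ = E_C ≍ a(K/L)³, ratio ≍ A′⁴/(64π² ρa³) → ∞) — such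
that for every δr > 0 there is δ > 0 with: every periodic δ-near-minimiser Ψ admits a
δr-near-minimiser Φ of the skeleton with (K:ℝ≥0∞)³ · condensateOccupation N L Ψ + ηNK³ ≥ (1 −
η)(N/K³) Σ_(x,y∈(ℤ/K)³) cosCorrelation Φ (e x) (e y). Since K³⟨φ₀,γ_Ψφ₀⟩ = Σ_(B,B′)⟨u_B, γ_Ψ u_B′⟩
over normalised block indicators, this is "block coherences of the gas dominate (1−η)·n̄ × skeleton
phase coherences". Intended mechanism: number–phase representation of block and pocket occupations
at INTEGER fillings (positivity-preserving charging semigroup), Kron/Feshbach reduction of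
intra-block modes keeping the ferromagnetic sign, Ginibre domination of the block-phase law of Ψ by
the skeleton ground state; accuracy η from depletion O(√(ρa³)), 1/m and pocket fraction K³m_p/N.
Sandwiched: complete periodic condensation ⇒ this ⇒ (with rank 2) PeriodicCondensation. [deps:
InhomogeneousRotorLRO] [difficulty: open-problem] (why it might fail: No correlation inequality
compares a continuum gas with a rotor array; the block plasma frequency 1/(xi l) is within a factor
4.4 of the first block phonon, so intra-block modes cannot be eliminated adiabatically and
non-ferromagnetic remainders carry no sign; 1-eta forces complete condensation.) [FisherEtAl1989,
Leggett2001, LSSY2005, Fournais2020, Junge2026, GarbanSpencer2022, MessagerMiraclesolePfister1978,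
Ginibre1970, DorflerBullo2013,
Literature.Barriers.AtomisticToContinuum.EnergyAsymptoticsWithoutCondensation]
#4 BoundaryTransferWeak (crux) — SHARED verbatim with stmt-AtomisticToContinuum-0827 (routes
BECPeriodicReduction, BECChargeConjugationRP, …; one proof serves all): for each repulsive
finite-range v, PeriodicBEC(v) ⇒ ∃ρ₀>0 ∀ρ∈(0,ρ₀) HasGroundStateBEC v ρ (Dirichlet ground state,
mode-free λ_max(γ) ≥ cN via condensateNumber). Expected route: Neumann bracketing of interior
sub-boxes + a mode-free criterion; only the ENERGY analogue is in print (LSSY2005 Ch. 2 after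
(2.8)). [deps: SkeletonDomination] [difficulty: L] (why it might fail: PeriodicBEC(v) is
ground-state-only (delta after N): the Dirichlet ground state is a periodic trial state lying a wall
term >> delta above E0^per, interior restrictions are neither periodic nor of sharp N; BEC is
boundary-condition sensitive (Robinson1976); only the ENERGY transfer is in print.)
[LiebSeiringerSolovejYngvason2005, Junge2026, Basti2022, BoccatoSeiringer2023, Robinson1976,
LauwersVerbeureZagrebnov2003]
#9 SkeletonCounting (support) — InhomogeneousRotorLRO → SkeletonDomination → PeriodicCondensation
(bookkeeping, no analysis): given v, take α_c from the engine, g := α_c + 1 ↦ (c₀, K₀); η := min(c₀,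
1)/4 ↦ (A, ρ₀) from the domination; for ρ < ρ₀ and eventually all N obtain K ≥ K₀, the skeleton and
its engine slack δ_e; feed δr := δ_e to get δ; for a δ-near-minimiser Ψ the witness Φ is
δ_e-near-minimal, so Σ cosCorrelation Φ ≥ c₀K⁶, whence ofReal((1−η)c₀NK³) ≤ K³·n₀(Ψ) + ofReal(ηNK³)
and n₀(Ψ) ≥ ((1−η)c₀ − η)N ≥ (c₀/2)N (ENNReal: ofReal monotone, tsub, cancel K³ ≠ 0, ⊤); c := c₀/2.
[difficulty: provable-now] [KLS1988PRL, LSSY2005]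

TWO-LAYER PLAN. Foreseen glued splits (k ≤ 3, depth 1; none filed now). SkeletonDomination ⇐
PhasePositivity (for near-minimisers at integer block/pocket fillings the
joint block-phase law — Fourier dual of the block-number law — is generalised-ferromagnetic up to a
remainder of relative size ε(ρ) → 0; the card's S2/S3)
→ SkeletonComparison (given positivity, Ginibre domination by the skeleton ground state with E_J,
E_C read off the in-tree cell theorems) →
SkeletonDomination. InhomogeneousRotorLRO ⇐ RotorGinibreMonotone (T = 0 Griffiths II for decorated
rotor arrays, via Trotter + the in-tree
ginibreExpect_reChar_mono extended to cone-valued factors) → HomogeneousRotorAnchor (the in-tree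
theorem KleinPerez1992_rotorGroundStateLRO_holds transferred to near-minimiser form at fixed large
even K) → InhomogeneousRotorLRO.
If PhasePositivity can only deliver a DEGENERATE skeleton (a sparse, percolation-like set of dead
bonds), the engine is WIDENED, not deepened: new item
DegenerateSkeletonLRO of DarioGarban2025 type (Wells' inequality + Peierls, or GarbanSpencer2022
synchronization) replaces rank 2 — the card's RP-free
engines enter exactly there. BoundaryTransferWeak is owned by BECPeriodicReduction's successors
(Neumann bracketing + mode-free criterion), not split here.

KILL CRITERIA. ¬InhomogeneousRotorLRO by a decorated array in which extra ferromagnetic bonds or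
pockets LOWER the torus coherence at T = 0 (failure of Ginibre
monotonicity for ground states) ⇒ the pocket device dies: restate rank 2 for the homogeneous torus
and re-file BECBlockRotorRP's FillingRemainder as a
crux — if that is judged as hard as BEC, close `superseded` by the RP sibling's successor.
¬SkeletonDomination as typed with a witness showing
condensateOccupation/N ↛ 1 along near-minimisers (incomplete condensation at small ρ) ⇒ misstated:
repair to a κ(v)-form (κ < 1); a witness showing that
NO ferromagnetic skeleton at the healing window is dominated (e.g. block coherences provably below
skeleton coherences for some admissible v) closes the
route `refuted:SkeletonDomination`. ¬BoundaryTransferWeak kills every periodic route, not only this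
one (shared pivot: run the engine in the Dirichlet
box with free spatial boundary of the skeleton — the decoration freedom of rank 2 was kept partly
for this). PeriodicBEC proved elsewhere moots ranks 2–3
(the route collapses to BoundaryTransferWeak); KleinPerez1992_rotorGroundStateLRO IS proved in tree
(2026-08-15, `_holds`, α_c = 16): rank 2 is the L-sized
monotonicity-and-transfer corollary described under RANKED CRUXES, no longer an anchor-proving job.

NOT DECOMPOSED YET. The interior of SkeletonDomination: the block/pocket number–phase representation
of an N-body near-minimiser as a Lean object (same missing
Feynman–Kac / second-quantised block layer as BECRenormGroup and BECVortexSheetDuality), the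
Kron/Feshbach step and its remainder norm, the choice of
m_p and of the pocket geometry, the transfer β = ∞ ↔ δ-near-minimiser at fixed (N, L); the constants
α_c, c₀ of the engine (WojtkiewiczPuszStachura2016:
α_c = 𝓘₃² ≈ 0.41); positive temperature; d = 2 (where the T = 0 engine also holds, KLS); the
Dirichlet-direct variant; the degenerate-skeleton engine
(see Two-layer plan). All are layer-2 children or widenings, filed only after a crux moves.

CHEAPEST FALSIFIER. (1) kit, about an hour (not run: no kit in this unit): exact diagonalisation of
the 2×2×2 Bose–Hubbard torus (filling m = 4–6, J/U = 2–10,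
|n−m| ≤ 4) with and without ONE pocket site (filling 2, coupling J′ ∈ {J/4, J, 4J}) on a corner: the
torus sum Σ⟨cos⟩ (normalised Re⟨b†_x b_y⟩) must
not decrease when the pocket is coupled — a decrease refutes T = 0 Ginibre monotonicity in the
smallest inhomogeneous instance and kills both the pocket
device and the intended proof of rank 2; offsetting the pocket's charging parabola by a flux α = 1/2
must visibly break positivity of the phase law.
(2) pencil, an afternoon (the card's dimer test sharpened): two Gross–Pitaevskii blocks with their
Bogoliubov modes — is the exact relative-phase weight
positive-definite (all Fourier coefficients ≥ 0) beyond the harmonic theta-function level, at orders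
1/m and (ξ/ℓ)²? A negative coefficient uniform in
m kills the EXACT-cone reading of rank 3 (approximate domination, η > 0, survives). (3) lookup: a
printed proof of Griffiths II for
quantum rotor GROUND states (Klein–Perez cite it without proof) would make rank 2 a vendoring job on
top of the in-tree anchor
`KleinPerez1992_rotorGroundStateLRO_holds` (the anchor lookup of the opening pass is settled: proved
in tree, 2026-08-15).

NUMBERS. ξ = (8πρa)^(-1/2); blocks ℓ = L/K = A ρ^(-1/2) = A′ξ; n̄ = m = ρℓ³ = A³ρ^(-1/2); E_J ≍ ρℓ
(ħ = 2m = 1), E_C ≍ 8πa/ℓ³, skeleton ratio E_J/E_C =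
ρℓ⁴/(8πa) = A′⁴/(64π² ρa³) → ∞ as ρ → 0 at fixed A′ (any g is reached); Josephson plasma frequency
√(E_J E_C) = 1/(ξℓ) versus first block phonon
c_s π/ℓ = √2 π/(ξℓ): ratio 4.4, NO scale separation (why rank 3 is an inequality, not an adiabatic
elimination); block phase fluctuation
⟨(δθ)²⟩ = O(√(ρa³)) in 3-D; rotor anchor threshold α_c(3) = 𝓘₃², 𝓘₃ ≈ 0.644
(WojtkiewiczPuszStachura2016 Thm 3.3); pocket bookkeeping: choose m_p ≍
m/8 coprime to K, m ≡ N·(K³)⁻¹ mod m_p maximal ≤ N/K³, then 0 ≤ r = (N − K³m)/m_p < K³ pockets, one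
per block corner at most; items at open: 6
(target, 3 cruxes of which 1 shared, 1 support, assembly). Cone (gate, 2026-08-15T18:55:50Z): 38
project constants, 0 unproved, `closes` native-OK;
the module-level named facts of the two Literature imports (BoseGas.Fournais2020_condensation,
LSSY2005_lowerBound_periodic,
LSSY2005_lowerBound_dirichlet, LSSY2005_upperBound_periodic;
QuantumRotor.KleinPerez1992_rotorGroundStateLRO) all have `_holds` discharges in tree
and none is a hypothesis of an item or of `closes`; both imports carry item vocabulary
(PeriodicTrialState/periodicEnergy/condensateOccupation;
QuantumRotor.TrialState/angleCell/cosCorrelation), so none is droppable.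

DEFINITION REQUESTS. None needed to type the items
(QuantumRotor.TrialState/angleCell/cosCorrelation, BoseGas.PeriodicTrialState/condensateOccupation,
TorusSite exist).
Optional, to shorten ranks 2–3 to one line each: `DecoratedRotorArray` (site-dependent inertia,
bond-dependent couplings: energy form, ground-state
energy, near-minimiser correlation) in Literature/MathematicalPhysics/QuantumLattice, filed after
open with `--for` the engine item. Cite-fact
wanted: Griffiths II / Ginibre monotonicity for quantum rotor GROUND-STATE correlations in the
couplings (KleinPerez1992 p. 243, folklore), as a named
Prop next to KleinPerez1992_rotorGroundStateLRO.

Novelty: Searches (2026-08-15; local searchd DOWN all session — `lit search`/`--hybrid`/`vsearch` rc 75 —,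
OpenAlex HTTP 429, arXiv API 0 rows; crossref and
galaxy answered): `lit frontier AtomisticToContinuum --since 2021` (30 rows; Bose descendants
arXiv:2510.20493, arXiv:2603.20776, arXiv:2602.16566,
arXiv:2605.06844 — none on block phases or lattice engines); crossref "Garban Spencer continuous
symmetry breaking Nishimori" → doi:10.1063/5.0087024;
"Dario Garban XY non-uniformly elliptic Poisson-Voronoi" → doi:10.1007/s00220-025-05269-7 (READ
arXiv:2311.16546 pp. 1–4: LRO for XY on supercritical
percolation clusters and Poisson–Voronoi graphs, d ≥ 3, via Wells' inequality; the authors note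
Ginibre gives monotonicity in the domain); "ground state
long range order quantum rotors inhomogeneous couplings Griffiths Ginibre" →
doi:10.1016/j.physa.2012.06.028 (Wojtkiewicz2012), doi:10.1103/physrevlett.23.828
(Ginibre 1969); "Griffiths inequalities quantum rotators long range order inhomogeneous" (10 rows,
nothing relevant); `lit galaxy search --star all
"quantum rotors long range order ground state"` (0), `--star pdf "Ginibre inequalities"` (3,
irrelevant), `--star pdf --mode intelligent` question on
Ginibre-comparison proofs of LRO/BEC (15 rows, none rigorous); the card's own log and its refuter
audit-32 (GarbanSpencer2022, AbbeEtAl2018,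
MessagerMiraclesolePfister1978, BenassiLeesUeltschi2016, arXiv:2311.16546); grep of the 87 Theses of
the sub for synchroni/Garban/Nishimori/Ginibre
(men  [refs: 10.1063/5.0087024, 10.1007/s00220-025-05269-7, 10.1016/j.physa.2012.06.028, 10.1103/physrevlett.23.828, 10.1016/s0034-4877(16, 10.1007/bf02096586, 2510.20493, 2603.20776, 2602.16566, 2605.06844, 2311.16546, doi:10.1063/5.0087024, doi:10.1007/s00220-025-05269-7, doi:10.1016/j.physa.2012.06.028, doi:10.1103/physrevlett.23.828, doi:10.1016/s0034-4877, doi:10.1007/bf02096586, Wojtkiewicz2012, GarbanSp]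

Barriers (technique_class: correlation-inequalities block-localization synchronization): - technique_class: correlation-inequalities block-localization synchronization
- Literature.Barriers.AtomisticToContinuum.HalfFillingReflectionPositivity: evaded on the Bose side
by construction — no reflection positivity of the gas or of the blocked gas is used; RP enters at
most INSIDE one admissible proof of the homogeneous rotor anchor (rank 2), where it is in print, and
the catalogue's caveat ("the obstruction is the absence of a known RP structure, not an
impossibility theorem") is respected; integer filling is needed for POSITIVITY of the phase
representation, not for RP, and the remainder N mod K³ is absorbed by pockets.
- Literature.Barriers.AtomisticToContinuum.HalfFillingReflectionPositivityNarrow: its proved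
rigidity rp_oddCharge_eq_zero constrains reflection-positive STATES; the skeleton's anchor lives in
the charge-0 sector of a particle–hole symmetric rotor array automatically (centred parabolas), and
the Bose-side statement SkeletonDomination is not an RP statement — not engaged.
- Literature.Barriers.AtomisticToContinuum.KineticGapLengthScales: gap methods act only inside
blocks of ONE fixed side A ρ^(-1/2) (healing window, where Fournais2020_condensation / LSSY Thm
5.1-type inputs are theorems); inter-block coherence comes from the engine, which has no gap and no
L² loss; the fixed-(N,L) gap is used only to pass from β = ∞ to δ-near-minimisers.
- Literature.Barriers.AtomisticToContinuum.BogoliubovPerturbationInfrared: no expansion around a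
c-number condensat

History (route lifecycle, newest last):
- 2026-08-25T02:38:10Z · DORMANT — reconciler: no traction for 7.3 d (last activity item-evidence-added at 2026-08-17T18:55:01Z); parked, not closed — `ledger route dormant route-AtomisticToConti (operator:999:3507462)
- 2026-08-29T03:29:37Z · REACTIVATED — reconciler: reactivated — activity statement-checked at 2026-08-29T01:17:37Z after parking at 2026-08-25T02:38:10Z (operator:999:327698)
- 2026-08-29T19:26:34Z · DORMANT — census g0: costume|duplicate of —; reader census-reader-33-g0 (operator:999:856765)

sub-problem: BoseEinsteinCondensation · status: dormant · opened planner-plancard-AtomisticToContinuum-BoseEin-03b50d27-g2-0 2026-08-15T18:54:17Z · rev 2 · ledger route-AtomisticToContinuum-BECSyncSkeleton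
GENERATED by the gate from the ledger (D-0016/17). Provers cite these decls: `theorem foo : Summit.AtomisticToContinuum.BoseEinsteinCondensation.Theses.BECSyncSkeleton.<Decl> := …` in Summits/AtomisticToContinuum/BoseEinsteinCondensation/Theorems/<Name>.lean.
-/

namespace Summit.AtomisticToContinuum.BoseEinsteinCondensation.Theses.BECSyncSkeleton

open scoped BigOperators Topology Manifold Classical MeasureTheory ProbabilityTheory Matrix InnerProductSpace ComplexConjugate ContinuousMap
open Filter Set Function TopologicalSpace MeasureTheory

attribute [summit_statement] _root_.BoseEinsteinCondensation

/-- item stmt-AtomisticToContinuum-8997 · target · rank 0 · open · by planner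
why it might fail: It is thermodynamic-limit BEC in the periodic setting (open since 1947): every printed bound on n+ pays the inverse kinetic gap L^2 (Fournais2020 Thm 1.2, Junge2026 Cor 6), and c must be uniform in N and cover hard cores.
sources: LSSY2005, Fournais2020, Junge2026
[target] constant-mode BEC for δ-near-minimisers of the periodic N-body energy on the torus of side
(N/ρ)^{1/3} at all small densities — verbatim the signature of BECPeriodicReduction.PeriodicBEC
(stmt-AtomisticToContinuum-0826); what X buys through ContinuationToPeriodicBEC (or
CoreSubharmonicCoherence through CoreContinuation). -/
@[route_item "route-AtomisticToContinuum-BECSyncSkeleton"]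
def PeriodicCondensation : Prop :=
  ∀ v : ℝ → ENNReal, Literature.MathematicalPhysics.QuantumManyBody.BoseGas.IsRepulsiveFiniteRange v → ∃ ρ₀ : ℝ, 0 < ρ₀ ∧ ∀ ρ : ℝ, 0 < ρ → ρ < ρ₀ → ∃ c : ℝ, 0 < c ∧ ∀ᶠ N : ℕ in Filter.atTop, ∃ δ : ENNReal, 0 < δ ∧ ∀ Ψ : Literature.MathematicalPhysics.QuantumManyBody.BoseGas.PeriodicTrialState N (Literature.MathematicalPhysics.QuantumManyBody.BoseGas.sideLength ρ N), Literature.MathematicalPhysics.QuantumManyBody.BoseGas.periodicEnergy v Ψ ≤ Literature.MathematicalPhysics.QuantumManyBody.BoseGas.periodicGroundStateEnergy v N (Literature.MathematicalPhysics.QuantumManyBody.BoseGas.sideLength ρ N) + δ → ENNReal.ofReal (c * N) ≤ Literature.MathematicalPhysics.QuantumManyBody.BoseGas.condensateOccupation N (Literature.MathematicalPhysics.QuantumManyBody.BoseGas.sideLength ρ N) Ψ.ψ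

/-- item stmt-AtomisticToContinuum-12371 · crux · rank 2 · open · by planner
why it might fail: T=0 Ginibre monotonicity for rotor arrays is folklore (KleinPerez1992 p.243, no printed proof); the in-tree anchor (alpha_c = 16) is a liminf over even tori of an inf-sup rendering, not a near-minimiser bound at fixed K; Trotter and beta->infinity limits must commute with the inequality.
sources: Ginibre1970, KleinPerez1992, WojtkiewiczPuszStachura2016, Wojtkiewicz2012, GarbanSpencer2022, DarioGarban2025
[crux] ENGINE (card item S1 / the anchor, made the first crux because the route's import cone rests
on the UNPROVED named fact QuantumRotor.KleinPerez1992_rotorGroundStateLRO, d = 3, T = 0). There is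
α_c > 0 and, for every g > α_c, constants c₀ > 0 and K₀ such that for every even K ≥ K₀, every n and
injective e : (ℤ/K)³ → Fin n, every inertia field h > 0 with h(e x) = h₀ and every symmetric
coupling J ≥ 0 with J(e x, e(x+e_i)) ≥ J₀, J₀/h₀ ≥ g (pockets and extra bonds arbitrary), the rotor
array H = Σ_a (h_a/2)(−∂²_φa) − Σ_(a<b) J_ab cos(φ_a − φ_b) on Fin n satisfies: for some δ > 0 every
δ-near-minimiser Ψ of its quadratic form (the in-tree QuantumRotor.TrialState / angleCell
vocabulary, energy written inline with site- and bond-dependent couplings) has Σ_(x,y∈(ℤ/K)³)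
cosCorrelation Ψ (e x) (e y) ≥ c₀K⁶. Intended proof: Ginibre II in the Trotterised path-space
representation (theta-function time kernels and e^(εJ cos) are in Ginibre's cone; monotone in every
J_ab — in tree as ginibreExpect_reChar_mono for exp-linear weights) removes pockets and extra bonds
and lowers torus bonds to J₀; the homogeneous even torus is the named fact
(WojtkiewiczPuszStachura2016 Thm 3.3 by RP + KLS; RP -/
@[route_item "route-AtomisticToContinuum-BECSyncSkeleton", crux]
def InhomogeneousRotorLRO : Prop :=
  ∃ αc : ℝ, 0 < αc ∧ ∀ g : ℝ, αc < g → ∃ c₀ : ℝ, 0 < c₀ ∧ ∃ K₀ : ℕ, ∀ (K : ℕ) [NeZero K], Even K → K₀ ≤ K → ∀ (n : ℕ) (e : Literature.Probability.LatticeModels.TorusSite 3 K → Fin n), Function.Injective e → ∀ (h : Fin n → ℝ) (J : Fin n → Fin n → ℝ) (h₀ J₀ : ℝ), 0 < h₀ → 0 < J₀ → g ≤ J₀ / h₀ → (∀ a, 0 < h a) → (∀ a b, J a b = J b a) → (∀ a b, 0 ≤ J a b) → (∀ x, h (e x) = h₀) → (∀ (x : Literature.Probability.LatticeModels.TorusSite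 3 K) (i : Fin 3), J₀ ≤ J (e x) (e (x + Pi.single i 1))) → let E : Literature.MathematicalPhysics.QuantumLattice.QuantumRotor.TrialState (Fin n) → ENNReal := fun Ψ => ∫⁻ φ in Literature.MathematicalPhysics.QuantumLattice.QuantumRotor.angleCell (Fin n), (∑ a, ENNReal.ofReal (h a / 2) * (‖fderiv ℝ Ψ.ψ φ (Pi.single a 1)‖₊ : ENNReal) ^ 2) + ENNReal.ofReal ((1 / 2) * ∑ a, ∑ b, J a b * (1 - Real.cos (φ a - φ b))) * (‖Ψ.ψ φ‖₊ : ENNReal) ^ 2; ∃ δ : ℝ, 0 < δ ∧ ∀ Ψ : Literature.MathematicalPhysics.QuantumLattice.QuantumRotor.TrialState (Fin n), E Ψ ≤ (⨅ Φ : Literature.MathematicalPhysics.QuantumLattice.QuantumRotor.TrialState (Fin n), E Φ) + ENNReal.ofReal δ → c₀ * (K : ℝ) ^ 6 ≤ ∑ x : Literature.Probability.LatticeModels.TorusSite 3 K, ∑ y : Literature.Probability.LatticeModels.TorusSite 3 K, Literature.MathematicalPhysics.QuantumLattice.QuantumRotor.cosCorrelation Ψ (e x) (e y)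

/-- item stmt-AtomisticToContinuum-12372 · crux · rank 3 · open · by planner
why it might fail: No correlation inequality compares a continuum gas with a rotor array; the block plasma frequency 1/(xi l) is within a factor 4.4 of the first block phonon, so intra-block modes cannot be eliminated adiabatically and non-ferromagnetic remainders carry no sign; 1-eta forces complete condensation.
sources: FisherEtAl1989, Leggett2001, LSSY2005, Fournais2020, Junge2026, GarbanSpencer2022
[crux] THE BET (card item S2, typed as a domination INEQUALITY with constant 1 − η rather than as a
bare implication). For every repulsive finite-range v, every g > 0 and η > 0 there are A > 0 and ρ₀
> 0 such that for 0 < ρ < ρ₀, every K₀ and all large N: there are an even K ≥ K₀ with A ρ^(-1/2) ≤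
L/K ≤ 2A ρ^(-1/2) (L = (N/ρ)^(1/3); ONE fixed healing-window scale) and a skeleton in the engine's
class — n, injective e : (ℤ/K)³ → Fin n, h > 0 with h = h₀ on blocks, symmetric J ≥ 0 with J ≥ J₀ on
block nearest-neighbour bonds, J₀/h₀ ≥ g (intended: K³ blocks of integer filling m, r = (N −
K³m)/m_p corner pockets of integer filling m_p ≫ 1 with gcd(K³, m_p) = 1, Josephson couplings E_J ≍
ρ(L/K), charging h₀ = E_C ≍ a(K/L)³, ratio ≍ A′⁴/(64π² ρa³) → ∞) — such that for every δr > 0 there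
is δ > 0 with: every periodic δ-near-minimiser Ψ admits a δr-near-minimiser Φ of the skeleton with
(K:ℝ≥0∞)³ · condensateOccupation N L Ψ + ηNK³ ≥ (1 − η)(N/K³) Σ_(x,y∈(ℤ/K)³) cosCorrelation Φ (e x)
(e y). Since K³⟨φ₀,γ_Ψφ₀⟩ = Σ_(B,B′)⟨u_B, γ_Ψ u_B′⟩ over normalised block indicators, this is "block
coherences of the gas dominate (1−η)·n̄ × skeleton phase coherences". Intended mechanism:
number–phase repre -/
@[route_item "route-AtomisticToContinuum-BECSyncSkeleton", crux]
def SkeletonDomination : Prop :=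
  ∀ v : ℝ → ENNReal, Literature.MathematicalPhysics.QuantumManyBody.BoseGas.IsRepulsiveFiniteRange v → ∀ g : ℝ, 0 < g → ∀ η : ℝ, 0 < η → ∃ A : ℝ, 0 < A ∧ ∃ ρ₀ : ℝ, 0 < ρ₀ ∧ ∀ ρ : ℝ, 0 < ρ → ρ < ρ₀ → ∀ K₀ : ℕ, ∀ᶠ N : ℕ in Filter.atTop, ∃ (K : ℕ) (_ : NeZero K), Even K ∧ K₀ ≤ K ∧ A / Real.sqrt ρ ≤ Literature.MathematicalPhysics.QuantumManyBody.BoseGas.sideLength ρ N / (K : ℝ) ∧ Literature.MathematicalPhysics.QuantumManyBody.BoseGas.sideLength ρ N / (K : ℝ) ≤ 2 * A / Real.sqrt ρ ∧ ∃ (n : ℕ) (e : Literature.Probability.LatticeModels.TorusSite 3 K → Fin n) (h : Fin n → ℝ) (J : Fin n → Fin n → ℝ) (h₀ J₀ : ℝ), Function.Injective e ∧ 0 < h₀ ∧ 0 < J₀ ∧ g ≤ J₀ / h₀ ∧ (∀ a, 0 < h a) ∧ (∀ a b, J a b = J b a) ∧ (∀ a b, 0 ≤ J a b) ∧ (∀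 x, h (e x) = h₀) ∧ (∀ (x : Literature.Probability.LatticeModels.TorusSite 3 K) (i : Fin 3), J₀ ≤ J (e x) (e (x + Pi.single i 1))) ∧ let E : Literature.MathematicalPhysics.QuantumLattice.QuantumRotor.TrialState (Fin n) → ENNReal := fun Φ => ∫⁻ φ in Literature.MathematicalPhysics.QuantumLattice.QuantumRotor.angleCell (Fin n), (∑ a, ENNReal.ofReal (h a / 2) * (‖fderiv ℝ Φ.ψ φ (Pi.single a 1)‖₊ : ENNReal) ^ 2) + ENNReal.ofReal ((1 / 2) * ∑ a, ∑ b, J a b * (1 - Real.cos (φ a - φ b))) * (‖Φ.ψ φ‖₊ : ENNReal) ^ 2; ∀ δr : ℝ, 0 < δr → ∃ δ : ENNReal, 0 < δ ∧ ∀ Ψ : Literature.MathematicalPhysics.QuantumManyBody.BoseGas.PeriodicTrialState N (Literature.MathematicalPhysics.QuantumManyBody.BoseGas.sideLength ρ N), Literature.MathematicalPhysics.QuantumManyBody.BoseGas.periodicEnergy v Ψ ≤ Literature.MathematicalPhysics.QuantumManyBody.BoseGas.periodicGroundStateEnergy v N (Literature.MathematicalPhysics.QuantumManyBody.BoseGas.sideLength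 ρ N) + δ → ∃ Φ : Literature.MathematicalPhysics.QuantumLattice.QuantumRotor.TrialState (Fin n), E Φ ≤ (⨅ Φ' : Literature.MathematicalPhysics.QuantumLattice.QuantumRotor.TrialState (Fin n), E Φ') + ENNReal.ofReal δr ∧ ENNReal.ofReal ((1 - η) * ((N : ℝ) / (K : ℝ) ^ 3) * ∑ x : Literature.Probability.LatticeModels.TorusSite 3 K, ∑ y : Literature.Probability.LatticeModels.TorusSite 3 K, Literature.MathematicalPhysics.QuantumLattice.QuantumRotor.cosCorrelation Φ (e x) (e y)) ≤ (K : ENNReal) ^ 3 * Literature.MathematicalPhysics.QuantumManyBody.BoseGas.condensateOccupation N (Literature.MathematicalPhysics.QuantumManyBody.BoseGas.sideLength ρ N) Ψ.ψ + ENNReal.ofReal (η * N * (K : ℝ) ^ 3)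

/-- item stmt-AtomisticToContinuum-0827 · crux · rank 4 · open · by planner
why it might fail: PeriodicBEC(v) is ground-state-only (delta after N): the Dirichlet ground state is a periodic trial state lying a wall term >> delta above E0^per, interior restrictions are neither periodic nor of sharp N; BEC is boundary-condition sensitive (Robinson1976); only the ENERGY transfer is in print.
sources: LiebSeiringerSolovejYngvason2005, Junge2026, Basti2022, BoccatoSeiringer2023, Robinson1976, LauwersVerbeureZagrebnov2003
[crux] BoundaryTransferWeak (mode-free boundary-condition transfer, per potential): for each
repulsive finite-range v, PeriodicBEC(v) implies ∃ρ₀>0 ∀ρ∈(0,ρ₀) HasGroundStateBEC v ρ (Dirichlet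
ground state, λ_max(γ) ≥ cN via condensateNumber). Not glue: near-minimiser slacks are O(N/L²) while
Dirichlet/periodic energies differ by a boundary term ≫ N/L², so no energy-comparison proof;
expected route: Neumann bracketing of interior sub-boxes (−Δ_Dir ≥ ⊕−Δ_Neu, v ≥ 0) + a mode-free
criterion (λ_max ≥ tr γ²/N). Only the ENERGY analogue is in print (LiebSeiringerSolovejYngvason2005
Ch. 2 after (2.8)). v ≡ 0: hypothesis and conclusion both true. -/
@[route_item "route-AtomisticToContinuum-BECSyncSkeleton", crux]
def BoundaryTransferWeak : Prop :=
  ∀ v : ℝ → ENNReal, Literature.MathematicalPhysics.QuantumManyBody.BoseGas.IsRepulsiveFiniteRange v → (∃ ρ₀ : ℝ, 0 < ρ₀ ∧ ∀ ρ : ℝ, 0 < ρ → ρ < ρ₀ → ∃ c : ℝ, 0 < c ∧ ∀ᶠ N : ℕ in Filter.atTop, ∃ δ : ENNReal, 0 < δ ∧ ∀ Ψ : Literature.MathematicalPhysics.QuantumManyBody.BoseGas.PeriodicTrialState N (Literature.MathematicalPhysics.QuantumManyBody.BoseGas.sideLength ρ N), Literature.MathematicalPhysics.QuantumManyBody.BoseGas.periodicEnergy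 v Ψ ≤ Literature.MathematicalPhysics.QuantumManyBody.BoseGas.periodicGroundStateEnergy v N (Literature.MathematicalPhysics.QuantumManyBody.BoseGas.sideLength ρ N) + δ → ENNReal.ofReal (c * N) ≤ Literature.MathematicalPhysics.QuantumManyBody.BoseGas.condensateOccupation N (Literature.MathematicalPhysics.QuantumManyBody.BoseGas.sideLength ρ N) Ψ.ψ) → ∃ ρ₀ : ℝ, 0 < ρ₀ ∧ ∀ ρ : ℝ, 0 < ρ → ρ < ρ₀ → Literature.MathematicalPhysics.QuantumManyBody.BoseGas.HasGroundStateBEC v ρ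

/-- item stmt-AtomisticToContinuum-12373 · support · rank 9 · closed · proved by Summit.AtomisticToContinuum.BoseEinsteinCondensation.Theorems.skeletonCounting_proof (prover) · by planner
sources: KLS1988PRL, LSSY2005
[support] InhomogeneousRotorLRO → SkeletonDomination → PeriodicCondensation (bookkeeping, no
analysis): given v, take α_c from the engine, g := α_c + 1 ↦ (c₀, K₀); η := min(c₀, 1)/4 ↦ (A, ρ₀)
from the domination; for ρ < ρ₀ and eventually all N obtain K ≥ K₀, the skeleton and its engine
slack δ_e; feed δr := δ_e to get δ; for a δ-near-minimiser Ψ the witness Φ is δ_e-near-minimal, so Σ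
cosCorrelation Φ ≥ c₀K⁶, whence ofReal((1−η)c₀NK³) ≤ K³·n₀(Ψ) + ofReal(ηNK³) and n₀(Ψ) ≥ ((1−η)c₀ −
η)N ≥ (c₀/2)N (ENNReal: ofReal monotone, tsub, cancel K³ ≠ 0, ⊤); c := c₀/2. [difficulty:
provable-now] -/
@[route_item "route-AtomisticToContinuum-BECSyncSkeleton", crux]
def SkeletonCounting : Prop :=
  InhomogeneousRotorLRO → SkeletonDomination → PeriodicCondensation

-- `SkeletonCounting` holds: proved by `Summit.AtomisticToContinuum.BoseEinsteinCondensation.Theorems.skeletonCounting_proof` (its module imports this route file, so no `_holds` link can be stated here).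

/-- item stmt-AtomisticToContinuum-12374 · assembly · rank 1 · closed · proved by Summit.AtomisticToContinuum.BoseEinsteinCondensation.Theorems.becSyncSkeleton_assembly_proof (prover) · by planner
sources: LSSY2005, KLS1988PRL, Ginibre1970
[assembly] InhomogeneousRotorLRO → SkeletonDomination → SkeletonCounting → BoundaryTransferWeak →
BoseEinsteinCondensation (identical to the type of `closes`). -/
@[route_item "route-AtomisticToContinuum-BECSyncSkeleton"]
def Assembly : Prop :=
  InhomogeneousRotorLRO → SkeletonDomination → SkeletonCounting → BoundaryTransferWeak → BoseEinsteinCondensation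

-- `Assembly` holds: proved by `Summit.AtomisticToContinuum.BoseEinsteinCondensation.Theorems.becSyncSkeleton_assembly_proof` (its module imports this route file, so no `_holds` link can be stated here).

/-! D-0027 §2.1 — DECIDING THEOREM (planner-authored via `route open/edit --closes-file`; by planner-plancard-AtomisticToContinuum-BoseEin-03b50d27-g2-0 2026-08-15T18:54:17Z):
its hypotheses are this route's items and its conclusion the sub-problem Statement (glue_lint), and it elaborates with this file. -/

/-- Route glue (D-0027 §2.1): the deciding theorem. Pure logic: for an admissible `v`,
`SkeletonCounting InhomogeneousRotorLRO SkeletonDomination v hv` is exactly the periodic-BEC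
hypothesis of `BoundaryTransferWeak v hv`, whose conclusion is the body of the sub-problem
Statement `BoseEinsteinCondensation` at `v`. `PeriodicCondensation` (target) is derived inside
`SkeletonCounting`, not assumed. -/
@[closes "route-AtomisticToContinuum-BECSyncSkeleton"] theorem closes (h₂ : InhomogeneousRotorLRO) (h₃ : SkeletonDomination) (h₉ : SkeletonCounting)
    (h₄ : BoundaryTransferWeak) : BoseEinsteinCondensation := by
  intro v hv
  exact h₄ v hv (h₉ h₂ h₃ v hv)

end Summit.AtomisticToContinuum.BoseEinsteinCondensation.Theses.BECSyncSkeleton
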